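import Mathlib
import Summits.CriticalPhenomena.PercolationContinuityZ3.Theorems.PercNearOneGluingNoHeavyLowerTailFatMinorityAveragedGluing
import Summits.CriticalPhenomena.PercolationContinuityZ3.Theorems.PercNearOneGluingNoHeavyLowerTailFatMinorityThinUnitsDeadness
import Summits.CriticalPhenomena.PercolationContinuityZ3.Theorems.PercNearOneGluingNoHeavyLowerTailFatMinorityThinUnitsNoFire
import Summits.CriticalPhenomena.PercolationContinuityZ3.Theorems.PercNearOneGluingNoHeavyLowerTailFatMinorityCounting
import HarnessLib

/-!
# `NoHeavyLowerTail` (stmt-CriticalPhenomena-4575), line fat-minority-linear — THIN UNITS, IV: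
# averaged gluing on a well-attached attachment pattern

Route task `nh-dp-fatminority` (gen 3).  The residual regime of the line named by gen 2
(`…FatMinorityCoherentUnits/DegreeGluing/Types/Ports.lean`, FINDINGS §3) is the one-layer observer
that is FAT (many private units, total coin mass `≫ 1`), INCOHERENT (units aiming at the relay
set through many different profiles) and has SMALL COINS.  This file closes that regime for
THIN units:

* `attachPattern_gluing` — per attachment pattern `T` (pinned weights `pinW w F T`) whose attached
  coin mass `W_T = Σ_{y ∈ R_T} s_y` satisfies `L ≤ κ W_T`:  the averaged gluing lemma
  (`averagedBlockGluing`, gen 2) applied to the block `{o} ∪ {unattached units}` with the relay set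
  `R_T` of ATTACHED UNITS and the COINS as weights `λ_y = s_y / L` gives
  `μ_T(o ↮ b) ≤ C (∏_{y ∈ R_T} (1 - p_y) + Σ_{y ∈ R_T} (s_y/L) μ_T(y ↮ b))`, `C = max(e, 2κ)`.
* `oneLayer_notConn_le_thinUnits` — **THEOREM.**  One-layer observer `o` (every positive neighbour
  `y` of `o` is private: `y ∉ A` and every other positive pair at `y` ends in `A`), coins
  `p_y = w(o,y) < 1`, `s_y = -log(1 - p_y)`, `π_y = 1 - ∏_a (1 - w(y,a))`,
  `Γ̃_y = ∏_a (1 + w(y,a)) - 1`.  If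
  `2 Σ_y s_y Γ̃_y ≤ κ Σ_y π_y p_y (1 - p_y)`   (thin units, coins bounded away from `1`), then
  `μ(o ↮ b) ≤ (C + 1) μ(o ↮ A) + C · max_{a ∈ A} μ(a ↮ b)`.
  The constant depends on NOTHING but `κ`: not on `|A|`, not on the number of units, not on the
  total coin mass `Σ_y p_y` (compare the degree class, `C = e · E deg o`), and not on the number
  or coherence of the attachment profiles (compare the coherent / `k`-types classes).  Per unit
  the hypothesis reads `2 (s_y/p_y) (Γ̃_y/π_y) ≤ κ (1 - p_y)`, i.e. `Γ̃_y/π_y ≈ 1 + Σ_a w(y,a)`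
  bounded (thin unit) and `p_y ≤ 1 - O(1/κ)`.
* `fatMinority_oneLayer_thinUnits` — the registered stub `stub_fatMinorityLinear` on this class,
  constant `2 (C + 1)`, `d₀ = 0`.

Proof of the theorem: law of total probability over the attachment patterns
(`prodBernoulli_real_inter_eq_sum_pinW`); well-attached patterns by `attachPattern_gluing`, then
`Σ_T μ([T]) ∏_{R_T}(1 - p) ≤ μ(o ↮ A)` (`attachPattern_sum_coinMiss_le`) and
`Σ_T μ([T]) 1{y ∈ R_T} μ_T(y ↮ b) = μ(y attached, y ↮ b) ≤ η Γ̃_y` (`unit_attached_notConn_le`);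
under-attached patterns have mass `≤ μ(o ↮ A)` by the Chernoff step `underAttached_mass_le`.
What remains open on the one-layer class after this file: FAT RANDOM UNITS (`Γ̃_y/π_y` large,
i.e. a unit attaching to many relays each with probability bounded away from `0` and `1`) and
coins `→ 1`; the former is exactly the multiplicative (Conjecture-1) form of the star gluing for
the unit's own star with `o` deleted.
-/

namespace Summit.CriticalPhenomena.PercolationContinuityZ3.Theorems

open MeasureTheory Set
open Literature.Probability.LatticeModels (prodBernoulli prodBernoulli_real_forall_notMem)
open Literature.Probability.Percolation (BondConfig openConn openGraph openGraph_adj pinW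
  localCylinder DeterminedBy determinedBy_iff prodBernoulli_real_inter_eq_sum_pinW
  determinedBy_univ pinW_apply_of_mem_of_mem pinW_apply_of_mem_of_not_mem pinW_apply_of_not_mem)
open scoped BigOperators

noncomputable section
open Classical

variable {n : ℕ}

/-! ## Gluing on a well-attached pattern -/

/-- **Averaged gluing on a well-attached attachment pattern.**  Units `U` (`o ∉ U`, `U ∩ A = ∅`,
every positive neighbour of `o` in `U`, every other positive pair at a unit ending in `A`, coins
`< 1`), a pattern `T ⊆ F` of the unit–relay pairs with attached set `R_T` and attached coin mass
`W_T = Σ_{y ∈ R_T} -log(1 - p_y)` satisfying `L ≤ κ W_T` (`L > 0`).  Under the pinned weights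
`q = pinW w F T` (the bound is used for `T ⊆ F`, but holds for every finite `T`):
`μ_q(o ↮ b) ≤ max(e,2κ) · ( ∏_{y ∈ R_T} (1 - p_y) + Σ_{y ∈ R_T} (s_y / L) μ_q(y ↮ b) )`.
Proof: `averagedBlockGluing` for the block `{o} ∪ (U ∖ R_T)` (the unattached units are pendant at
`o` under `q`), relay set `R_T`, weights `s_y/L`; the coherence condition is `L ≤ κ W_T`.
[cite: KozmaNitzan2024, §3.2 Theorem 4 and Lemma 5 (pp. 12–14)] -/
theorem attachPattern_gluing (w : Sym2 (Fin n) → unitInterval) (U A : Finset (Fin n)) (o b : Fin n)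
    (T : Finset (Sym2 (Fin n))) (L κ : ℝ) (hκ : 0 ≤ κ) (hL : 0 < L)
    (hoU : o ∉ U) (hoA : o ∉ A) (hUA : Disjoint U A) (hb : b ∈ A)
    (hU : ∀ y : Fin n, y ≠ o → w s(o, y) ≠ 0 → y ∈ U)
    (hX : ∀ y ∈ U, ∀ z : Fin n, z ≠ o → z ∉ A → w s(y, z) = 0)
    (hcoin : ∀ y ∈ U, (w s(o, y) : ℝ) < 1)
    (hwell : L ≤ κ * ∑ y ∈ U.filter (fun y => ∃ a ∈ A, s(y, a) ∈ T),
      -Real.log (1 - (w s(o, y) : ℝ))) :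
    (prodBernoulli (pinW w (↑(U.biUnion fun y => A.image fun a => s(y, a)) : Set (Sym2 (Fin n)))
        ↑T)).real (openConn o b)ᶜ ≤
      max (Real.exp 1) (2 * κ) *
        (∏ y ∈ U.filter (fun y => ∃ a ∈ A, s(y, a) ∈ T), (1 - (w s(o, y) : ℝ)) +
          ∑ y ∈ U.filter (fun y => ∃ a ∈ A, s(y, a) ∈ T), -Real.log (1 - (w s(o, y) : ℝ)) / L *
            (prodBernoulli (pinW w (↑(U.biUnion fun y => A.image fun a => s(y, a)) :
              Set (Sym2 (Fin n))) ↑T)).real (openConn y b)ᶜ) := by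
  have hmeas : ∀ s : Set (BondConfig (Fin n)), MeasurableSet s := fun _ => MeasurableSet.of_discrete
  set F : Finset (Sym2 (Fin n)) := U.biUnion fun y => A.image fun a => s(y, a) with hF
  set R : Finset (Fin n) := U.filter (fun y => ∃ a ∈ A, s(y, a) ∈ T) with hR
  set q : Sym2 (Fin n) → unitInterval := pinW w (↑F : Set (Sym2 (Fin n))) ↑T with hq
  set C : ℝ := max (Real.exp 1) (2 * κ) with hC
  have hC0 : 0 ≤ C := le_trans (Real.exp_pos 1).le (le_max_left _ _)
  set O : Finset (Fin n) := insert o (U \ R) with hO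
  have hUA' : ∀ y ∈ U, y ∉ A := fun y hy => Finset.disjoint_left.1 hUA hy
  have hRU : R ⊆ U := Finset.filter_subset _ _
  -- membership in `F`
  have hF_mem : ∀ e, e ∈ F ↔ ∃ y ∈ U, ∃ a ∈ A, e = s(y, a) := by
    intro e
    simp only [hF, Finset.mem_biUnion, Finset.mem_image]
    constructor
    · rintro ⟨y, hy, a, ha, rfl⟩; exact ⟨y, hy, a, ha, rfl⟩
    · rintro ⟨y, hy, a, ha, rfl⟩; exact ⟨y, hy, a, ha, rfl⟩
  have hoF : ∀ v, s(o, v) ∉ F := by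
    intro v hv
    obtain ⟨y, hy, a, ha, h⟩ := (hF_mem _).1 hv
    rcases Sym2.eq_iff.1 h with ⟨h1, _⟩ | ⟨h1, _⟩
    · exact hoU (h1 ▸ hy)
    · exact hoA (h1 ▸ ha)
  have hnotA_F : ∀ y ∈ U, ∀ v, v ∉ A → s(y, v) ∉ F := by
    intro y hy v hv hmem
    obtain ⟨y', _, a', ha', h⟩ := (hF_mem _).1 hmem
    rcases Sym2.eq_iff.1 h with ⟨_, h2⟩ | ⟨h1, _⟩
    · exact hv (h2 ▸ ha')
    · exact hUA' y hy (h1 ▸ ha')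
  -- values of the pinned weights
  have hq_o : ∀ v, q s(o, v) = w s(o, v) := fun v => pinW_apply_of_not_mem w _ (hoF v)
  have hq_unatt : ∀ y ∈ U \ R, ∀ v, v ≠ o → q s(y, v) = 0 := by
    intro y hy v hvo
    rw [Finset.mem_sdiff] at hy
    by_cases hvA : v ∈ A
    · have hmemF : s(y, v) ∈ (↑F : Set (Sym2 (Fin n))) := by
        rw [Finset.mem_coe, hF_mem]; exact ⟨y, hy.1, v, hvA, rfl⟩
      have hnT : s(y, v) ∉ (↑T : Set (Sym2 (Fin n))) := by
        intro h
        apply hy.2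
        rw [hR, Finset.mem_filter]
        exact ⟨hy.1, v, hvA, Finset.mem_coe.1 h⟩
      exact pinW_apply_of_mem_of_not_mem w hmemF hnT
    · rw [hq, pinW_apply_of_not_mem w _ (hnotA_F y hy.1 v hvA)]
      exact hX y hy.1 v hvo hvA
  -- hypotheses of the averaged gluing lemma
  have hOA : Disjoint O R := by
    rw [hO, Finset.disjoint_insert_left]
    exact ⟨fun h => hoU (hRU h), Finset.sdiff_disjoint⟩
  have hbO : b ∉ O := by
    rw [hO, Finset.mem_insert, Finset.mem_sdiff]
    rintro (rfl | ⟨hbU, -⟩)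
    · exact hoA hb
    · exact hUA' b hbU hb
  have hstar : ∀ x ∈ O, ∀ v : Fin n, v ∉ O → v ∉ R → q s(x, v) = 0 := by
    intro x hx v hvO hvR
    have hvo : v ≠ o := fun h => hvO (h ▸ Finset.mem_insert_self _ _)
    have hvU : v ∉ U := fun h => by
      by_cases hvR' : v ∈ R
      · exact hvR hvR'
      · exact hvO (Finset.mem_insert_of_mem (Finset.mem_sdiff.2 ⟨h, hvR'⟩))
    rw [hO, Finset.mem_insert] at hx
    rcases hx with rfl | hx
    · rw [hq_o]
      by_contra h
      exact hvU (hU v hvo h)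
    · exact hq_unatt x hx v hvo
  have hlt : ∀ x ∈ O, ∀ a ∈ R, (q s(x, a) : ℝ) < 1 := by
    intro x hx y' hy'
    have hy'U : y' ∈ U := hRU hy'
    have hy'o : y' ≠ o := fun h => hoU (h ▸ hy'U)
    rw [hO, Finset.mem_insert] at hx
    rcases hx with rfl | hx
    · rw [hq_o]; exact hcoin y' hy'U
    · rw [hq_unatt x hx y' hy'o]; norm_num
  have hs0 : ∀ y ∈ U, 0 ≤ -Real.log (1 - (w s(o, y) : ℝ)) := by
    intro y hy
    have h1 : 0 < 1 - (w s(o, y) : ℝ) := by linarith [hcoin y hy]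
    have h2 : 1 - (w s(o, y) : ℝ) ≤ 1 := by linarith [(w s(o, y)).2.1]
    linarith [Real.log_nonpos h1.le h2]
  have hsumO : ∀ y' ∈ R, ∑ x ∈ O, -Real.log (1 - (q s(x, y') : ℝ)) =
      -Real.log (1 - (w s(o, y') : ℝ)) := by
    intro y' hy'
    have hy'U : y' ∈ U := hRU hy'
    have hy'o : y' ≠ o := fun h => hoU (h ▸ hy'U)
    have hoUR : o ∉ U \ R := fun h => hoU (Finset.mem_sdiff.1 h).1
    rw [hO, Finset.sum_insert hoUR, hq_o, Finset.sum_eq_zero fun x hx => ?_, add_zero]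
    rw [hq_unatt x hx y' hy'o]; simp
  have hcoh : ∀ a ∈ R, ∑ x ∈ O, -Real.log (1 - (q s(x, a) : ℝ)) ≤
      κ * (-Real.log (1 - (w s(o, a) : ℝ)) / L) *
        ∑ a' ∈ R, ∑ x ∈ O, -Real.log (1 - (q s(x, a') : ℝ)) := by
    intro y' hy'
    rw [hsumO y' hy', Finset.sum_congr rfl hsumO]
    have hW : 1 ≤ κ * (∑ a' ∈ R, -Real.log (1 - (w s(o, a') : ℝ))) / L := by
      rw [le_div_iff₀ hL, one_mul]; exact hwell
    have hs := hs0 y' (hRU hy')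
    calc -Real.log (1 - (w s(o, y') : ℝ)) = -Real.log (1 - (w s(o, y') : ℝ)) * 1 := (mul_one _).symm
      _ ≤ -Real.log (1 - (w s(o, y') : ℝ)) *
            (κ * (∑ a' ∈ R, -Real.log (1 - (w s(o, a') : ℝ))) / L) :=
          mul_le_mul_of_nonneg_left hW hs
      _ = _ := by ring
  -- the averaged gluing lemma
  have key := averagedBlockGluing q O R b (fun y => -Real.log (1 - (w s(o, y) : ℝ)) / L) κ hκ hOA
    hbO hstar hlt (fun y hy => div_nonneg (hs0 y (hRU hy)) hL.le) hcoh
  -- (a) the block reaches `b` only through `o`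
  have hLHS : (prodBernoulli q).real (openConn o b)ᶜ ≤
      (prodBernoulli q).real (⋃ x ∈ O, openConn x b)ᶜ := by
    have hsub : (⋃ x ∈ O, (openConn x b : Set (BondConfig (Fin n)))) ∩
        {ω | ∀ e : Sym2 (Fin n), q e = 0 → e ∉ ω} ⊆ openConn o b := by
      rintro ω ⟨hU', hnull⟩
      simp only [Set.mem_iUnion, exists_prop] at hU'
      obtain ⟨x, hx, hxb⟩ := hU'
      rw [hO, Finset.mem_insert] at hx
      rcases hx with rfl | hx
      · exact hxb
      · have hxU : x ∈ U := (Finset.mem_sdiff.1 hx).1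
        have hxb_ne : x ≠ b := fun h => hUA' x hxU (h ▸ hb)
        exact reachable_of_pendant q hnull x o b hxb_ne
          (fun z hzx hzo => hq_unatt x hx z hzo) hxb
    have h1 : (prodBernoulli q).real (⋃ x ∈ O, (openConn x b : Set (BondConfig (Fin n)))) ≤
        (prodBernoulli q).real (openConn o b) := by
      calc (prodBernoulli q).real (⋃ x ∈ O, (openConn x b : Set (BondConfig (Fin n))))
          = (prodBernoulli q).real ((⋃ x ∈ O, (openConn x b : Set (BondConfig (Fin n)))) ∩
              {ω | ∀ e : Sym2 (Fin n), q e = 0 → e ∉ ω}) := by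
            refine measureReal_congr ?_
            filter_upwards [ae_null_closed q] with ω hω
            exact propext ⟨fun h => ⟨h, hω⟩, fun h => h.1⟩
        _ ≤ _ := measureReal_mono hsub
    rw [probReal_compl_eq_one_sub (hmeas _), probReal_compl_eq_one_sub (hmeas _)]
    linarith
  -- (b) no open pair from the block: at most the attached coins all closed
  have hnoPair : (prodBernoulli q).real {ω : BondConfig (Fin n) | ∀ x ∈ O, ∀ a ∈ R, s(x, a) ∉ ω} ≤
      ∏ y ∈ R, (1 - (w s(o, y) : ℝ)) := by
    have hinj : Set.InjOn (fun y => s(o, y)) ↑R := fun a _ a' _ h => Sym2.congr_right.1 h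
    have hsub : {ω : BondConfig (Fin n) | ∀ x ∈ O, ∀ a ∈ R, s(x, a) ∉ ω} ⊆
        {ω | ∀ e ∈ R.image (fun y => s(o, y)), e ∉ ω} := by
      intro ω hω e he
      obtain ⟨y, hy, rfl⟩ := Finset.mem_image.1 he
      exact hω o (Finset.mem_insert_self _ _) y hy
    refine le_trans (measureReal_mono hsub) (le_of_eq ?_)
    rw [prodBernoulli_real_forall_notMem, Finset.prod_image hinj]
    exact Finset.prod_congr rfl fun y _ => by rw [hq_o]
  -- assemble
  have hsum0 : 0 ≤ ∑ a ∈ R, -Real.log (1 - (w s(o, a) : ℝ)) / L *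
      (prodBernoulli q).real (openConn a b)ᶜ :=
    Finset.sum_nonneg fun y hy => mul_nonneg (div_nonneg (hs0 y (hRU hy)) hL.le) measureReal_nonneg
  calc (prodBernoulli q).real (openConn o b)ᶜ
      ≤ (prodBernoulli q).real (⋃ x ∈ O, openConn x b)ᶜ := hLHS
    _ ≤ C * ((prodBernoulli q).real {ω : BondConfig (Fin n) | ∀ x ∈ O, ∀ a ∈ R, s(x, a) ∉ ω} +
          ∑ a ∈ R, -Real.log (1 - (w s(o, a) : ℝ)) / L * (prodBernoulli q).real (openConn a b)ᶜ) :=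
        key
    _ ≤ C * (∏ y ∈ R, (1 - (w s(o, y) : ℝ)) +
          ∑ a ∈ R, -Real.log (1 - (w s(o, a) : ℝ)) / L * (prodBernoulli q).real (openConn a b)ᶜ) :=
        mul_le_mul_of_nonneg_left (by linarith [hnoPair]) hC0

end

end Summit.CriticalPhenomena.PercolationContinuityZ3.Theorems
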